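import Summits.QuantumFields.YangMills.Theorems.BalabanUVNodesN15PerCubeGreenTwoGridKnitDefect
import Summits.QuantumFields.YangMills.Theorems.BalabanUVNodesN15PerCubeGreenCovariant
import Summits.QuantumFields.YangMills.Theorems.BalabanUVNodesN15PerCubeGreenFineCovariant
import HarnessLib

/-!
# N15 = NE2, road (c) — PROGRAMME (PC) «[B9] Sect. C FOR THE LANDAU LETTER WITH PER-CUBE GAUGES (3.35) AS PRINTED», (PC-E) (C6-a): THE TWO-GRID η-DEFECT OF THE SCALAR COVARIANT
# GREEN's FUNCTIONS `G′(U′)` ∕ `G′(U)` THEMSELVES — n15-c∕339 with Bałaban's summand `P := a·Q′_TᵀQ′_T` LIVE on both grids and every one-grid small-field row PRODUCED from the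
# POINTWISE (3.35) letters of the transformed bond variables in the cube gauges (fine `u′_k`, coarse INDUCED `u′_k∘σ`): what stays displayed is exactly the PAIRING data — the
# coarse letters and the three two-grid fits `hfitC hfitA hDNV` (dag-n15-c g32, n15-c∕340)

Cell `pub-ymgap`, seat `pub-ymgap-dag-n15-c` (generation g32; R134 (a) seat, strategy s1 «first missing estimate»; HUMAN RULING D-0062; chair R424 venue).
`bears_on: R4∕N15 · K3⁸ SpineGivenEndpointR13SepCoPHV (stmt-QuantumFields-27366)`; filed `--kind proof --supports stmt-QuantumFields-27366 --as helper` — COUNT-NEUTRAL.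
ONE theorem, 0 `def`, 0 `sorry`; bookkeeping over landed rows, NO new estimate; `maxHeartbeats 800000` for the size of 339's displayed rows only (n15-c∕339's
budget; every step is a one-line application).  Imports BY NAME n15-c∕339 `…PerCubeGreenTwoGridKnitDefect` (★★★ `uN_idef_scGlued_tr`), n15-c∕265
`…PerCubeGreenCovariant` (through it n15-c∕264 `…PerCubeGreenSummand`: `scP`, `scNV`, `scP_conj`, `hasMaj_scNV_cut_of_rows`, `one_sub_scPsi_comp_scNV_comp_scChi`; dag-n15-w2 g6
`…CurvedLocalCoefLettersOfReg335UN`: `rowSum_tCoefA_inl_le_at`, `rowSum_tCoefA_inr_le_at`, `rowSum_tCoefC_le_at`, `uN_abs_coordMat_conj_sub_one_entry_le_op`,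
`uN_abs_coordMat_conj_sub_conj_entry_le_op`) and n15-c∕265′ `…PerCubeGreenFineCovariant` (the fine twins `scP′`, `scNV′`, `scP'_conj`, `hasMaj_scNV'_cut_of_rows`,
`one_sub_scPsi'_comp_scNV'_comp_scChi'`); dag-n15-a ✓p796072 `mulOp_one_sub_scPsi_comp_csavgGram_comp_mulOp_scH` through 339.  Nothing in the tree is modified, no landed name re-declared.

THE THEOREM `uN_idef_scGreen_tr`.  n15-c∕339 `uN_idef_scGlued_tr` bounds the η-defect through the covariant transport `τ_{Ad∘U′}` of the glued operators for ABSTRACT summands `P, P′` and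
perturbations `N_V, N′_V` with twenty displayed rows.  HERE the summand is Bałaban's: `P := scP = a·Q′_T(U)ᵀQ′_T(U)`, `P′ := scP′` (so that `Δ_{R_U} + P = Δ′_a(U)` and the glued operators
are `G′(U)`, `G′(U′)` by n15-c∕265∕265′), `N_V k := scNV … (u′_k∘σ) U k`, `N′_V k := scNV′ … u′_k U′ k`; and of 339's displayed rows the following are PRODUCED: `hP`∕`hP′` (definitional,
`scP_conj`), `hfarN`∕`hfarN′` (ZERO: block-diagonal perturbation, cut box inside the cube), `hDfarN` (ZERO: the η-defect of two zeros), `hPloc` (the covariant Gram is block-diagonal,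
✓p796072), `hNVcut`∕`hNVcut′` (from the forward coefficient letters, `hasMaj_scNV_cut_of_rows`∕′, `|a_K·n^{d+1}|·n^{−(d+1)} = a_K ≤ a₀`), the (3.35) coefficient letters `hCloc hAloc hCloc′
hAloc′` (dag-n15-w2's pointwise rows `rowSum_tCoefA_inl∕inr_le_at`, `rowSum_tCoefC_le_at` with the orthogonality cancellation, from the POINTWISE operator-norm letters of the transformed
bond variables `V′ = u′_kU′u′_kᴴ` on sets `Qf k ⊇` cut box `− e′_μ`, and `V = (u′_k∘σ)U(u′_k∘σ)ᴴ` on sets `Qc k`), and the column letter `hρ` of `Ad V′` on the plateau cube (`Qf k ⊇`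
plateau).  DISPLAYED (the PAIRING data, (C6-b)∕(C6-c)'s object): the pointwise letters `‖V′_μ(z) − 1‖ ≤ η′p`, `‖V′_μ(z) − V′_μ(z − e′_μ)‖ ≤ η′²q` on `Qf k` ((3.35) on the fine box:
dag-n15-w2 `uN_exists_gauge_opLetters_of_reg335Cube`), the SAME letters for the coarse `V` in the induced gauge on `Qc k` (the covariant fit of PAIRING (i)), the species fits `hfitC`∕`hfitA`
and the two-grid defect `hDNV` of the cut perturbations, and the numeric thresholds `|ι|κ_e2√|m|√|m|p ≤ r_V`, `|ι||J|(|ι|(κ_e2√|m|√|m|p)² + κ_e2√|m|√|m|q) ≤ r_V`,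
`r_V(1+|J⊕J|) + a₀|ι|(|ι|σ_c² + 2σ_c) + a₀|ι|(|ι|σ_f² + 2σ_f) ≤ R₀` (`σ_c = (1 + r_Vη)^{(d+1)L^k} − 1`, `σ_f` likewise on the fine grid), `o_V(1+|J⊕J|) + o_N ≤ o`.  CONCLUSION: the
η-defect of `scGlued′ … u′ U′ (scP′) (scNV′)` against `scGlued … (u′∘σ) U (scP) (scNV)` through `τ_{Ad∘U′}` is `≤ D·((L^k)^{−1∕4} + o + s)·e^{−(δ∕16)d}`, `s = (1+ρ)^{(d+1)(L^r−1)} − 1`,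
`ρ = |ι|·η′·κ_e2√|m|√|m|p` (`η′ = (L^rL^k)^{−1}`).

HONEST FRAMING ∕ LIMITS.  Bookkeeping on MODEL carriers ((PC-E-A) level: the SCALAR covariant Green's function; the dictionary `scGlued … (scP) (scNV) = G′(U)` is n15-c∕265∕266's); the
displayed pointwise letters and fits are the paper's (3.35) hypotheses in the cube gauges plus the PAIRING of the two backgrounds, whose producers are NOT here — LOCATED: the coarse
letters in the INDUCED gauge and `hfitA`∕`hDNV` need the pairing `U = Ū(U′)` ([B7] (124)–(125)) with (3.35) for `U′`; `hfitC` (the zeroth-order coefficient carries the divergence term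
`∂^{η*}A′` of (3.52)) needs (3.36) «|∂^{η*}∂^ηA| < O(1)Mα₀(L^jη)^{−3}» (r06 `Reg336Cube`) — «later on we will have to assume (3.36) also» (p.396).  NOT [B9] Thm 3.14 as printed;
nothing of [B5]∕[B6]∕[B7]∕[B9] asserted.  NE2⁺ NOT PRINTED, NOT proved; N15 of record untouched (DISCHARGED AS CONSUMED, p687738); K3⁸ OPEN; counts of record UNMOVED (typed 28∕28 ·
discharged 8∕27); one finite 𝕋⁴ at fixed ε per index — NOT infinite volume, NOT OS on ℝ⁴, NOT a mass gap, NOT Clay; R4 closes the conditional finite-𝕋⁴ rung `BalabanLadder.UV` only.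
Restate-immune (no Theses import).
-/

noncomputable section

open scoped BigOperators Matrix Matrix.Norms.L2Operator

namespace Summit.QuantumFields.YangMills.BalabanUVNodes.N15.Gluing

open Real
open Literature.MathematicalPhysics.QuantumFieldTheory.Balaban1983to89
open Literature.MathematicalPhysics.QuantumFieldTheory.Balaban1983to89.B5Prop11Plancherel (Tor fine unitVec)
open Literature.MathematicalPhysics.QuantumFieldTheory.Balaban1983to89.B11SectG (BlockNorm HasMaj hasMaj_zero)
open Literature.MathematicalPhysics.QuantumFieldTheory.Balaban1983to89.T4EtaRateDefect (idef idef_zero)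
open Literature.MathematicalPhysics.QuantumFieldTheory.Balaban1983to89.T4EtaRateCoeffDefect (pull)
open Literature.MathematicalPhysics.QuantumFieldTheory.Balaban1983to89.B6Prop26Gluing (mulOp mulOp_apply ind ind_nonneg)
open Literature.MathematicalPhysics.QuantumFieldTheory.Balaban1983to89.B6UnitTorusCarrier (unitTorusGeo unitTorusGeo_dist_nonneg)
open Literature.MathematicalPhysics.QuantumFieldTheory.Balaban1983to89.B5SiteBridgeP12 (MP)
open Literature.MathematicalPhysics.QuantumFieldTheory.King1986 (aK aK_pos aK_le)
open Literature.MathematicalPhysics.QuantumFieldTheory.King1986.Torus (blockOf)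
open Literature.Barriers.QuantumFields (traceForm)
open Summit.QuantumFields.YangMills.BalabanUVNodes.N15.BackgroundLayer (covLapM tCoefA tCoefC)
open Summit.QuantumFields.YangMills.BalabanUVNodes.N15.VectorPiece (kingPr)
open Summit.QuantumFields.YangMills.BalabanUVNodes.N15.MatrixSpecies (mmulOp coordMat basisConst basisConst_nonneg liftBlk liftMap liftEquiv)
open Summit.QuantumFields.YangMills.BalabanUVNodes.N15.TwoGrid (chiCube cubeBlocks)
open Summit.QuantumFields.YangMills.BalabanUVNodes.N15.CurvedSpecies (gaugePair rowSum_tCoefA_inl_le_at rowSum_tCoefA_inr_le_at rowSum_tCoefC_le_at uN_abs_coordMat_conj_sub_one_entry_le_op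
  uN_abs_coordMat_conj_sub_conj_entry_le_op uN_coordMat_conj_orthogonal uN_gaugeTransformed_bond_unitary)
open Summit.QuantumFields.YangMills.BalabanUVNodes.N15.CovLandau (csavg)
open Summit.QuantumFields.YangMills.BalabanUVNodes.N15.CovAvg (kingSec ctauS)

variable {d : ℕ}

section Green

variable {L : ℕ} [NeZero L]

set_option maxHeartbeats 800000 in
/-- ★★★ **THE TWO-GRID η-DEFECT OF THE SCALAR COVARIANT GREEN's FUNCTIONS WITH PER-CUBE GAUGES, THROUGH THE COVARIANT TRANSPORT — Bałaban's summand LIVE, every one-grid row produced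
from the POINTWISE (3.35) letters in the cube gauges.**  For odd `L ≥ 7`, `a₀ > 0`, a colour index `ι`: there are `δ, w₀, R₀ > 0` and `D` such that on every doubled torus of the cover
(`k ≥ 1`, `L^m ≥ w₀`) and every refinement `r ≥ 1`, for trace-form coordinates `e` of `M_m(ℂ)`, unitary fine cube gauges `u′_k`, unitary bond fields `U` (coarse) ∕ `U′` (fine), sets
`Qf k` containing the fine cut box, its `−e′_μ` neighbours and the plateau cube, sets `Qc k` containing the coarse cut box and its `−e_μ` neighbours, pointwise letters `p, q` of the
transformed bond variables (`‖V′ − 1‖ ≤ η′p`, `‖V′(z) − V′(z−e′_μ)‖ ≤ η′²q` on `Qf k`; the same with `η` for `V = (u′_k∘σ)U(u′_k∘σ)ᴴ` on `Qc k`), the numeric thresholds displayed, and the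
PAIRING fits `hfitC hfitA hDNV`: the η-defect through `τ_{Ad∘U′}` of `G′(U′)` (= `scGlued′ … (scP′) (scNV′)`) against `G′(U)` (= `scGlued … (scP) (scNV)`, INDUCED gauges) is
`≤ D·((L^k)^{−1∕4} + o + ((1+ρ)^{(d+1)(L^r−1)} − 1))·e^{−(δ∕16)|y−y′|_T}`, `ρ = |ι|η′κ_e2√|m|√|m|p`.  MODEL carriers; the SHAPE of [B9] Thm 3.14 for `G′`, NOT the printed theorem.
[cite: Balaban1985BackgroundPropagators, Thm 3.14 pp.426–427 (template), (3.24)–(3.25) p.394, (3.34)–(3.36) p.396, (3.50)–(3.52) p.400, (3.59)–(3.60) p.402, Cor. 3.8 p.410; Balaban1985Averaging, (124)–(125) p.36 (pairing: shape);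
King1986, p.664 (pairing)] -/
theorem uN_idef_scGreen_tr (hL : Odd L ∧ 1 < L) (hL7 : 7 ≤ L) {a₀ : ℝ} (ha₀ : 0 < a₀) (ι : Type) [Fintype ι] [DecidableEq ι] :
    ∃ δ w₀ R₀ D : ℝ, 0 < δ ∧ 0 < R₀ ∧ ∀ (mv kk r : ℕ), 1 ≤ kk → 1 ≤ r → w₀ ≤ ((L ^ mv : ℕ) : ℝ) →
      ∀ {mm : Type} [Fintype mm] [DecidableEq mm] [Nonempty mm] (e : Matrix mm mm ℂ ≃L[ℝ] (ι → ℝ)), (∀ A B : Matrix mm mm ℂ, traceForm A B = e A ⬝ᵥ e B) →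
      ∀ (u' : (Fin (d + 1) → ZMod (2 * L)) → ScX' d L mv kk r hL → Matrix mm mm ℂ), (∀ k x', (u' k x')ᴴ * u' k x' = 1) →
      ∀ (U : Fin (d + 1) → ScX d L mv kk hL → Matrix mm mm ℂ), (∀ μ x, (U μ x)ᴴ * U μ x = 1) → ∀ (U' : Fin (d + 1) → ScX' d L mv kk r hL → Matrix mm mm ℂ), (∀ μ x', (U' μ x')ᴴ * U' μ x' = 1) →
      ∀ (Qf : (Fin (d + 1) → ZMod (2 * L)) → Set (ScX' d L mv kk r hL)) (Qc : (Fin (d + 1) → ZMod (2 * L)) → Set (ScX d L mv kk hL)) (p q : ℝ), 0 ≤ p → 0 ≤ q →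
        (∀ k x', scChi' d L mv kk r hL k x' ≠ 0 → x' ∈ Qf k ∧ ∀ μ, (scShift' d L mv kk r hL μ).symm x' ∈ Qf k) → (∀ k y', scBlk' d L mv kk r hL y' ∈ cvSk d L mv kk hL k → y' ∈ Qf k) →
        (∀ k x, scChi d L mv kk hL k x ≠ 0 → x ∈ Qc k ∧ ∀ μ, (scShift d L mv kk hL μ).symm x ∈ Qc k) →
        -- the POINTWISE (3.35) letters of the transformed bond variables: fine, in the cube gauge `u′_k`, on `Qf k`
        (∀ k μ z, z ∈ Qf k → ‖(u' k z * U' μ z * (u' k (scShift' d L mv kk r hL μ z))ᴴ) - 1‖ ≤ ((((L ^ r * L ^ kk : ℕ) : ℝ))⁻¹) * p) →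
        (∀ k μ z, z ∈ Qf k → ‖(u' k z * U' μ z * (u' k (scShift' d L mv kk r hL μ z))ᴴ) - (u' k ((scShift' d L mv kk r hL μ).symm z) * U' μ ((scShift' d L mv kk r hL μ).symm z) * (u' k (scShift' d L mv kk r hL μ ((scShift' d L mv kk r hL μ).symm z)))ᴴ)‖ ≤ ((((L ^ r * L ^ kk : ℕ) : ℝ))⁻¹) ^ 2 * q) →
        -- … and coarse, in the INDUCED gauge `u′_k∘σ`, on `Qc k` (the covariant fit of the PAIRING, displayed)
        (∀ k μ x, x ∈ Qc k → ‖(u' k (kingSec (cvM d L mv kk hL) L kk r x) * U μ x * (u' k (kingSec (cvM d L mv kk hL) L kk r (scShift d L mv kk hL μ x)))ᴴ) - 1‖ ≤ ((((L ^ kk : ℕ) : ℝ))⁻¹) * p) →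
        (∀ k μ x, x ∈ Qc k → ‖(u' k (kingSec (cvM d L mv kk hL) L kk r x) * U μ x * (u' k (kingSec (cvM d L mv kk hL) L kk r (scShift d L mv kk hL μ x)))ᴴ) - (u' k (kingSec (cvM d L mv kk hL) L kk r ((scShift d L mv kk hL μ).symm x)) * U μ ((scShift d L mv kk hL μ).symm x) * (u' k (kingSec (cvM d L mv kk hL) L kk r (scShift d L mv kk hL μ ((scShift d L mv kk hL μ).symm x))))ᴴ)‖ ≤ ((((L ^ kk : ℕ) : ℝ))⁻¹) ^ 2 * q) →
      ∀ (rV oV oN o : ℝ), 0 ≤ rV → 0 ≤ oV → 0 ≤ oN →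
        Fintype.card ι * (@basisConst ι _ (Matrix mm mm ℂ) Matrix.frobeniusNormedAddCommGroup Matrix.frobeniusNormedSpace e * (2 * Real.sqrt (Fintype.card mm)) * (Real.sqrt (Fintype.card mm) * p)) ≤ rV → Fintype.card ι * (Fintype.card (Fin (d + 1)) * (Fintype.card ι * (@basisConst ι _ (Matrix mm mm ℂ) Matrix.frobeniusNormedAddCommGroup Matrix.frobeniusNormedSpace e * (2 * Real.sqrt (Fintype.card mm)) * (Real.sqrt (Fintype.card mm) * p)) ^ 2 + (@basisConst ι _ (Matrix mm mm ℂ) Matrix.frobeniusNormedAddCommGroup Matrix.frobeniusNormedSpace e * (2 * Real.sqrt (Fintype.card mm)) * (Real.sqrt (Fintype.card mm) * q)))) ≤ rV →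
        rV * (1 + Fintype.card (Fin (d + 1) ⊕ Fin (d + 1))) + (a₀ * (Fintype.card ι * (Fintype.card ι * ((1 + rV * ((((L ^ kk : ℕ) : ℝ))⁻¹)) ^ ((d + 1) * L ^ kk) - 1) ^ 2 + 2 * ((1 + rV * ((((L ^ kk : ℕ) : ℝ))⁻¹)) ^ ((d + 1) * L ^ kk) - 1))) + a₀ * (Fintype.card ι * (Fintype.card ι * ((1 + rV * ((((L ^ r * L ^ kk : ℕ) : ℝ))⁻¹)) ^ ((d + 1) * (L ^ r * L ^ kk)) - 1) ^ 2 + 2 * ((1 + rV * ((((L ^ r * L ^ kk : ℕ) : ℝ))⁻¹)) ^ ((d + 1) * (L ^ r * L ^ kk)) - 1)))) ≤ R₀ → oV * (1 + Fintype.card (Fin (d + 1) ⊕ Fin (d + 1))) + oN ≤ o →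
        -- the three two-grid fits of the PAIRING (displayed)
        (∀ k x' i, ∑ j, |(scChi' d L mv kk r hL k x' • tCoefC ((((L ^ r * L ^ kk : ℕ) : ℝ))⁻¹) (gaugePair (scShift' d L mv kk r hL) fun μ x' => coordMat e (ContinuousLinearMap.mulLeftRight ℝ (Matrix mm mm ℂ) (u' k x' * U' μ x' * (u' k (scShift' d L mv kk r hL μ x'))ᴴ) (u' k x' * U' μ x' * (u' k (scShift' d L mv kk r hL μ x'))ᴴ)ᴴ)) x') i j - (scChi d L mv kk hL k ((kingPr L kk r (cvM d L mv kk hL)) x') • tCoefC ((((L ^ kk : ℕ) : ℝ))⁻¹) (gaugePair (scShift d L mv kk hL) fun μ x => coordMat e (ContinuousLinearMap.mulLeftRight ℝ (Matrix mm mm ℂ) (u' k (kingSec (cvM d L mv kk hL) L kk r x) * U μ x * (u' k (kingSec (cvM d L mv kk hL) L kk r (scShift d L mv kk hL μ x)))ᴴ) (u' k (kingSec (cvM d L mv kk hL) L kk r x) * U μ x * (u' k (kingSec (cvM d L mv kk hL) L kk r (scShift d L mv kk hL μ x)))ᴴ)ᴴ)) ((kingPr L kk r (cvM d L mv kk hL))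 x')) i j| ≤ oV) →
        (∀ k j' x' i, ∑ j, |(scChi' d L mv kk r hL k x' • tCoefA ((((L ^ r * L ^ kk : ℕ) : ℝ))⁻¹) (gaugePair (scShift' d L mv kk r hL) fun μ x' => coordMat e (ContinuousLinearMap.mulLeftRight ℝ (Matrix mm mm ℂ) (u' k x' * U' μ x' * (u' k (scShift' d L mv kk r hL μ x'))ᴴ) (u' k x' * U' μ x' * (u' k (scShift' d L mv kk r hL μ x'))ᴴ)ᴴ)) j' x') i j - (scChi d L mv kk hL k ((kingPr L kk r (cvM d L mv kk hL)) x') • tCoefA ((((L ^ kk : ℕ) : ℝ))⁻¹) (gaugePair (scShift d L mv kk hL) fun μ x => coordMat e (ContinuousLinearMap.mulLeftRight ℝ (Matrix mm mm ℂ) (u' k (kingSec (cvM d L mv kk hL) L kk r x) * U μ x * (u' k (kingSec (cvM d L mv kk hL) L kk r (scShift d L mv kk hL μ x)))ᴴ) (u' k (kingSec (cvM d L mv kk hL) L kk r x) * U μ x * (u' k (kingSec (cvM d L mv kk hL) L kk r (scShift d L mv kk hL μ x)))ᴴ)ᴴ)) j' ((kingPr L kk r (cvM d L mv kk hL)) x'))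 i j| ≤ oV) →
        (∀ k, HasMaj (ScNorm d L mv kk hL ι) (BlockNorm.ofBlocks (unitTorusGeo L kk (cvM d L mv kk hL)) (liftBlk (scBlk d L mv kk hL ∘ kingPr L kk r (cvM d L mv kk hL)) ι)) (idef (pull (liftMap (kingPr L kk r (cvM d L mv kk hL)) ι)) (pull (liftMap (kingPr L kk r (cvM d L mv kk hL)) ι)) (mulOp (fun p : ScX' d L mv kk r hL × ι => scPsi' d L mv kk r hL k p.1) ∘ₗ (scNV' d L mv kk r hL (aK a₀ (L : ℝ) (r + kk) * (((L ^ r * L ^ kk : ℕ) : ℝ)) ^ (d + 1)) ι e u' U' k) ∘ₗ mulOp (fun p : ScX' d L mv kk r hL × ι => scChi' d L mv kk r hL k p.1)) (mulOp (fun p : ScX d L mv kk hL × ι => scPsi d L mv kk hL k p.1) ∘ₗ (scNV d L mv kk hL (aK a₀ (L : ℝ) kk * (((L ^ kk : ℕ) : ℝ)) ^ (d + 1)) ι e (fun k x => u' k (kingSec (cvM d L mv kk hL) L kk r x)) U k) ∘ₗ mulOp (fun p : ScX d L mv kk hL × ι => scChi d L mv kk hL k p.1))) (fun y y' => oN * Real.exp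 (-(δ * (unitTorusGeo L kk (cvM d L mv kk hL)).dist y y')))) →
        HasMaj (ScNorm d L mv kk hL ι) (BlockNorm.ofBlocks (unitTorusGeo L kk (cvM d L mv kk hL)) (liftBlk (scBlk d L mv kk hL ∘ kingPr L kk r (cvM d L mv kk hL)) ι))
          (idef (ctauS (cvM d L mv kk hL) L kk r (fun μ x' => coordMat e (ContinuousLinearMap.mulLeftRight ℝ (Matrix mm mm ℂ) (U' μ x') (U' μ x')ᴴ))) (ctauS (cvM d L mv kk hL) L kk r (fun μ x' => coordMat e (ContinuousLinearMap.mulLeftRight ℝ (Matrix mm mm ℂ) (U' μ x') (U' μ x')ᴴ))) (scGlued' d L mv kk r hL (aK a₀ (L : ℝ) (r + kk) * (((L ^ r * L ^ kk : ℕ) : ℝ)) ^ (d + 1)) ((((L ^ r * L ^ kk : ℕ) : ℝ))⁻¹) ι e u' U' (scP' d L mv kk r hL (aK a₀ (L : ℝ) (r + kk) * (((L ^ r * L ^ kk : ℕ) : ℝ)) ^ (d + 1)) ι e U') (scNV' d L mv kk r hL (aK a₀ (L : ℝ) (r + kk) * (((L ^ r * L ^ kk : ℕ) : ℝ)) ^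 (d + 1)) ι e u' U')) (scGlued d L mv kk hL (aK a₀ (L : ℝ) kk * (((L ^ kk : ℕ) : ℝ)) ^ (d + 1)) ((((L ^ kk : ℕ) : ℝ))⁻¹) ι e (fun k x => u' k (kingSec (cvM d L mv kk hL) L kk r x)) U (scP d L mv kk hL (aK a₀ (L : ℝ) kk * (((L ^ kk : ℕ) : ℝ)) ^ (d + 1)) ι e U) (scNV d L mv kk hL (aK a₀ (L : ℝ) kk * (((L ^ kk : ℕ) : ℝ)) ^ (d + 1)) ι e (fun k x => u' k (kingSec (cvM d L mv kk hL) L kk r x)) U)))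
          (fun y y' => D * (((L : ℝ) ^ kk) ^ (-(1 / 4 : ℝ)) + (o + ((1 + (Fintype.card ι * (((((L ^ r * L ^ kk : ℕ) : ℝ))⁻¹) * (@basisConst ι _ (Matrix mm mm ℂ) Matrix.frobeniusNormedAddCommGroup Matrix.frobeniusNormedSpace e * (2 * Real.sqrt (Fintype.card mm)) * (Real.sqrt (Fintype.card mm) * p))))) ^ ((d + 1) * (L ^ r - 1)) - 1))) * Real.exp (-(δ / 16 * (unitTorusGeo L kk (cvM d L mv kk hL)).dist y y'))) := by
  obtain ⟨δ, w₀, R₀, θ₀, D, hδ, hR₀, hθ₀, H⟩ := uN_idef_scGlued_tr (d := d) hL hL7 ha₀ ι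
  have hL1r : (1 : ℝ) < (L : ℝ) := (by exact_mod_cast hL.2); have hL3 : 3 ≤ L := (by omega); have hLpos : 0 < L := (by omega)
  refine ⟨δ, max w₀ 3, R₀, D, hδ, hR₀, fun mv kk r hk hr hw₀ => ?_⟩
  intro mm _ _ _ e he u' hu' U hU U' hU' Qf Qc p q hp hq hQf hQρ hQc hF1 hF2 hC1 hC2 rV oV oN o hrV hoV hoN hrA hrC hRle hole hfitC hfitA hDNV
  have hw₀' : w₀ ≤ ((L ^ mv : ℕ) : ℝ) := (le_max_left _ _).trans hw₀
  have hW3 : 3 ≤ L ^ mv := by have h := (le_max_right w₀ 3).trans hw₀; exact_mod_cast h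
  have hW2 : 2 ≤ L ^ mv := (by omega); have hw : 0 < L ^ mv := (by omega)
  have hη : (0 : ℝ) < ((((L ^ kk : ℕ) : ℝ))⁻¹) := inv_pos.mpr (Nat.cast_pos.mpr (pow_pos hLpos kk))
  have hη' : (0 : ℝ) < ((((L ^ r * L ^ kk : ℕ) : ℝ))⁻¹) := inv_pos.mpr (Nat.cast_pos.mpr (Nat.mul_pos (pow_pos hLpos r) (pow_pos hLpos kk)))
  have hM : ∀ ν, cvM d L mv kk hL ν = 2 * L * L ^ mv := MP_succ_eq L mv kk hL
  have hm₁ : 2 * L ^ mv ≤ coverMargin L mv := two_mul_le_coverMargin hL7 mv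
  have hfitI : coverMargin L mv - 2 * L ^ mv + (6 * L ^ mv + 1) ≤ L * L ^ mv := coverMargin_inner_fit hL7 hW2
  have hS0 : L * L ^ mv ≤ 2 * L * L ^ mv := (by rw [mul_assoc]; omega)
  have hmg₂ : 2 * L ^ mv + 1 ≤ coverMargin L mv := (coverMargin_cut_margin hL7 hW3).1
  have hfg₂ : coverMargin L mv - 2 * L ^ mv + (6 * L ^ mv + 1) + 1 ≤ L * L ^ mv := (coverMargin_cut_margin hL7 hW3).2
  have hS6 : 6 * L ^ mv + 1 ≤ 2 * L * L ^ mv := by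
    have h7 : 7 * L ^ mv ≤ L * L ^ mv := Nat.mul_le_mul_right _ hL7
    have e7 : 2 * L * L ^ mv = 2 * (L * L ^ mv) := by ring
    rw [e7]; omega
  -- King's windows at both indices
  have haK : 0 < aK a₀ (L : ℝ) kk := aK_pos ha₀ hL1r hk
  have haKle : aK a₀ (L : ℝ) kk ≤ a₀ := aK_le ha₀ hL1r hk
  have ha' : 0 < (aK a₀ (L : ℝ) kk * (((L ^ kk : ℕ) : ℝ)) ^ (d + 1)) := by positivity
  have haK' : 0 < aK a₀ (L : ℝ) (r + kk) := aK_pos ha₀ hL1r (hk.trans (Nat.le_add_left kk r))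
  have haKle' : aK a₀ (L : ℝ) (r + kk) ≤ a₀ := aK_le ha₀ hL1r (hk.trans (Nat.le_add_left kk r))
  have ha'' : 0 < (aK a₀ (L : ℝ) (r + kk) * (((L ^ r * L ^ kk : ℕ) : ℝ)) ^ (d + 1)) := by positivity
  have habs : |(aK a₀ (L : ℝ) kk * (((L ^ kk : ℕ) : ℝ)) ^ (d + 1))| * ((((L ^ kk : ℕ) : ℝ)) ^ (d + 1))⁻¹ = aK a₀ (L : ℝ) kk := by rw [abs_of_pos ha', mul_assoc, mul_inv_cancel₀ (by positivity), mul_one]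
  have habs' : |(aK a₀ (L : ℝ) (r + kk) * (((L ^ r * L ^ kk : ℕ) : ℝ)) ^ (d + 1))| * ((((L ^ r * L ^ kk : ℕ) : ℝ)) ^ (d + 1))⁻¹ = aK a₀ (L : ℝ) (r + kk) := by rw [abs_of_pos ha'', mul_assoc, mul_inv_cancel₀ (by positivity), mul_one]
  -- the letters of the cut rows
  have hσc0 : 0 ≤ ((1 + rV * ((((L ^ kk : ℕ) : ℝ))⁻¹)) ^ ((d + 1) * L ^ kk) - 1) := by
    have := one_le_pow₀ (M₀ := ℝ) (a := 1 + rV * ((((L ^ kk : ℕ) : ℝ))⁻¹)) (by nlinarith [hη.le]) (n := (d + 1) * L ^ kk); linarith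
  have hσf0 : 0 ≤ ((1 + rV * ((((L ^ r * L ^ kk : ℕ) : ℝ))⁻¹)) ^ ((d + 1) * (L ^ r * L ^ kk)) - 1) := by
    have := one_le_pow₀ (M₀ := ℝ) (a := 1 + rV * ((((L ^ r * L ^ kk : ℕ) : ℝ))⁻¹)) (by nlinarith [hη'.le]) (n := (d + 1) * (L ^ r * L ^ kk)); linarith
  have hSc0 : 0 ≤ (Fintype.card ι * (Fintype.card ι * ((1 + rV * ((((L ^ kk : ℕ) : ℝ))⁻¹)) ^ ((d + 1) * L ^ kk) - 1) ^ 2 + 2 * ((1 + rV * ((((L ^ kk : ℕ) : ℝ))⁻¹)) ^ ((d + 1) * L ^ kk) - 1))) := (by positivity); have hSf0 : 0 ≤ (Fintype.card ι * (Fintype.card ι * ((1 + rV * ((((L ^ r * L ^ kk : ℕ) : ℝ))⁻¹)) ^ ((d + 1) * (L ^ r * L ^ kk)) - 1) ^ 2 + 2 * ((1 + rV * ((((L ^ r * L ^ kk : ℕ) : ℝ))⁻¹)) ^ ((d + 1) * (L ^ r * L ^ kk)) - 1))) := (by positivity)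
  have hRN0 : 0 ≤ a₀ * (Fintype.card ι * (Fintype.card ι * ((1 + rV * ((((L ^ kk : ℕ) : ℝ))⁻¹)) ^ ((d + 1) * L ^ kk) - 1) ^ 2 + 2 * ((1 + rV * ((((L ^ kk : ℕ) : ℝ))⁻¹)) ^ ((d + 1) * L ^ kk) - 1))) + a₀ * (Fintype.card ι * (Fintype.card ι * ((1 + rV * ((((L ^ r * L ^ kk : ℕ) : ℝ))⁻¹)) ^ ((d + 1) * (L ^ r * L ^ kk)) - 1) ^ 2 + 2 * ((1 + rV * ((((L ^ r * L ^ kk : ℕ) : ℝ))⁻¹)) ^ ((d + 1) * (L ^ r * L ^ kk)) - 1))) := by positivity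
  -- the induced coarse gauge, the transformed bond variables, unitarity ∕ orthogonality
  have hW : ∀ (k : Fin (d + 1) → ZMod (2 * L)) (x : ScX d L mv kk hL), ((fun k x => u' k (kingSec (cvM d L mv kk hL) L kk r x)) k x)ᴴ * (fun k x => u' k (kingSec (cvM d L mv kk hL) L kk r x)) k x = 1 := fun k x => hu' k _
  have hV'u : ∀ (k : Fin (d + 1) → ZMod (2 * L)) (μ : Fin (d + 1)) (z : ScX' d L mv kk r hL), (u' k z * U' μ z * (u' k (scShift' d L mv kk r hL μ z))ᴴ)ᴴ * (u' k z * U' μ z * (u' k (scShift' d L mv kk r hL μ z))ᴴ) = 1 := fun k μ z => uN_gaugeTransformed_bond_unitary (scShift' d L mv kk r hL) (u' k) U' (hu' k) hU' μ z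
  have hVu : ∀ (k : Fin (d + 1) → ZMod (2 * L)) (μ : Fin (d + 1)) (x : ScX d L mv kk hL), (u' k (kingSec (cvM d L mv kk hL) L kk r x) * U μ x * (u' k (kingSec (cvM d L mv kk hL) L kk r (scShift d L mv kk hL μ x)))ᴴ)ᴴ * (u' k (kingSec (cvM d L mv kk hL) L kk r x) * U μ x * (u' k (kingSec (cvM d L mv kk hL) L kk r (scShift d L mv kk hL μ x)))ᴴ) = 1 := fun k μ x => uN_gaugeTransformed_bond_unitary (scShift d L mv kk hL) ((fun k x => u' k (kingSec (cvM d L mv kk hL) L kk r x)) k) U (hW k) hU μ x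
  have hκ0 : 0 ≤ @basisConst ι _ (Matrix mm mm ℂ) Matrix.frobeniusNormedAddCommGroup Matrix.frobeniusNormedSpace e * (2 * Real.sqrt (Fintype.card mm)) := mul_nonneg (@basisConst_nonneg ι _ (Matrix mm mm ℂ) Matrix.frobeniusNormedAddCommGroup Matrix.frobeniusNormedSpace e) (by positivity)
  have hP10 : 0 ≤ (@basisConst ι _ (Matrix mm mm ℂ) Matrix.frobeniusNormedAddCommGroup Matrix.frobeniusNormedSpace e * (2 * Real.sqrt (Fintype.card mm)) * (Real.sqrt (Fintype.card mm) * p)) := by positivity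
  -- the entry letters (dag-n15-w2 §2), both grids
  have hE1' : ∀ (k : Fin (d + 1) → ZMod (2 * L)) (μ : Fin (d + 1)) (z : ScX' d L mv kk r hL), z ∈ Qf k → ∀ i j, |((fun μ x' => coordMat e (ContinuousLinearMap.mulLeftRight ℝ (Matrix mm mm ℂ) (u' k x' * U' μ x' * (u' k (scShift' d L mv kk r hL μ x'))ᴴ) (u' k x' * U' μ x' * (u' k (scShift' d L mv kk r hL μ x'))ᴴ)ᴴ)) μ z - 1) i j| ≤ ((((L ^ r * L ^ kk : ℕ) : ℝ))⁻¹) * (@basisConst ι _ (Matrix mm mm ℂ) Matrix.frobeniusNormedAddCommGroup Matrix.frobeniusNormedSpace e * (2 * Real.sqrt (Fintype.card mm)) * (Real.sqrt (Fintype.card mm) * p)) := fun k μ z hz i j => by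
    refine (uN_abs_coordMat_conj_sub_one_entry_le_op e (hV'u k μ z) i j).trans ?_
    calc @basisConst ι _ (Matrix mm mm ℂ) Matrix.frobeniusNormedAddCommGroup Matrix.frobeniusNormedSpace e * (2 * Real.sqrt (Fintype.card mm)) * (Real.sqrt (Fintype.card mm) * ‖(u' k z * U' μ z * (u' k (scShift' d L mv kk r hL μ z))ᴴ) - 1‖) ≤ @basisConst ι _ (Matrix mm mm ℂ) Matrix.frobeniusNormedAddCommGroup Matrix.frobeniusNormedSpace e * (2 * Real.sqrt (Fintype.card mm)) * (Real.sqrt (Fintype.card mm) * (((((L ^ r * L ^ kk : ℕ) : ℝ))⁻¹) * p)) := by gcongr; exact hF1 k μ z hz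
      _ = ((((L ^ r * L ^ kk : ℕ) : ℝ))⁻¹) * (@basisConst ι _ (Matrix mm mm ℂ) Matrix.frobeniusNormedAddCommGroup Matrix.frobeniusNormedSpace e * (2 * Real.sqrt (Fintype.card mm)) * (Real.sqrt (Fintype.card mm) * p)) := by ring
  have hE2' : ∀ (k : Fin (d + 1) → ZMod (2 * L)) (μ : Fin (d + 1)) (z : ScX' d L mv kk r hL), z ∈ Qf k → ∀ i j, |((fun μ x' => coordMat e (ContinuousLinearMap.mulLeftRight ℝ (Matrix mm mm ℂ) (u' k x' * U' μ x' * (u' k (scShift' d L mv kk r hL μ x'))ᴴ) (u' k x' * U' μ x' * (u' k (scShift' d L mv kk r hL μ x'))ᴴ)ᴴ)) μ z - (fun μ x' => coordMat e (ContinuousLinearMap.mulLeftRight ℝ (Matrix mm mm ℂ) (u' k x' * U' μ x' * (u' k (scShift' d L mv kk r hL μ x'))ᴴ) (u' k x' * U' μ x' * (u' k (scShift' d L mv kk r hL μ x'))ᴴ)ᴴ)) μ ((scShift' d L mv kk r hL μ).symm z)) i j| ≤ ((((L ^ r * L ^ kk : ℕ) : ℝ))⁻¹) ^ 2 * (@basisConst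 ι _ (Matrix mm mm ℂ) Matrix.frobeniusNormedAddCommGroup Matrix.frobeniusNormedSpace e * (2 * Real.sqrt (Fintype.card mm)) * (Real.sqrt (Fintype.card mm) * q)) := fun k μ z hz i j => by
    refine (uN_abs_coordMat_conj_sub_conj_entry_le_op e (hV'u k μ ((scShift' d L mv kk r hL μ).symm z)) (hV'u k μ z) i j).trans ?_
    calc @basisConst ι _ (Matrix mm mm ℂ) Matrix.frobeniusNormedAddCommGroup Matrix.frobeniusNormedSpace e * (2 * Real.sqrt (Fintype.card mm)) * (Real.sqrt (Fintype.card mm) * ‖(u' k z * U' μ z * (u' k (scShift' d L mv kk r hL μ z))ᴴ) - (u' k ((scShift' d L mv kk r hL μ).symm z) * U' μ ((scShift' d L mv kk r hL μ).symm z) * (u' k (scShift' d L mv kk r hL μ ((scShift' d L mv kk r hL μ).symm z)))ᴴ)‖) ≤ @basisConst ι _ (Matrix mm mm ℂ) Matrix.frobeniusNormedAddCommGroup Matrix.frobeniusNormedSpace e * (2 * Real.sqrt (Fintype.card mm)) * (Real.sqrt (Fintype.card mm) * (((((L ^ r * L ^ kk : ℕ) : ℝ))⁻¹) ^ 2 *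 q)) := by gcongr; exact hF2 k μ z hz
      _ = ((((L ^ r * L ^ kk : ℕ) : ℝ))⁻¹) ^ 2 * (@basisConst ι _ (Matrix mm mm ℂ) Matrix.frobeniusNormedAddCommGroup Matrix.frobeniusNormedSpace e * (2 * Real.sqrt (Fintype.card mm)) * (Real.sqrt (Fintype.card mm) * q)) := by ring
  have hE1 : ∀ (k : Fin (d + 1) → ZMod (2 * L)) (μ : Fin (d + 1)) (x : ScX d L mv kk hL), x ∈ Qc k → ∀ i j, |((fun μ x => coordMat e (ContinuousLinearMap.mulLeftRight ℝ (Matrix mm mm ℂ) (u' k (kingSec (cvM d L mv kk hL) L kk r x) * U μ x * (u' k (kingSec (cvM d L mv kk hL) L kk r (scShift d L mv kk hL μ x)))ᴴ) (u' k (kingSec (cvM d L mv kk hL) L kk r x) * U μ x * (u' k (kingSec (cvM d L mv kk hL) L kk r (scShift d L mv kk hL μ x)))ᴴ)ᴴ)) μ x - 1) i j| ≤ ((((L ^ kk : ℕ) : ℝ))⁻¹) * (@basisConst ι _ (Matrix mm mm ℂ) Matrix.frobeniusNormedAddCommGroup Matrix.frobeniusNormedSpace e * (2 * Real.sqrt (Fintype.card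 mm)) * (Real.sqrt (Fintype.card mm) * p)) := fun k μ x hx i j => by
    refine (uN_abs_coordMat_conj_sub_one_entry_le_op e (hVu k μ x) i j).trans ?_
    calc @basisConst ι _ (Matrix mm mm ℂ) Matrix.frobeniusNormedAddCommGroup Matrix.frobeniusNormedSpace e * (2 * Real.sqrt (Fintype.card mm)) * (Real.sqrt (Fintype.card mm) * ‖(u' k (kingSec (cvM d L mv kk hL) L kk r x) * U μ x * (u' k (kingSec (cvM d L mv kk hL) L kk r (scShift d L mv kk hL μ x)))ᴴ) - 1‖) ≤ @basisConst ι _ (Matrix mm mm ℂ) Matrix.frobeniusNormedAddCommGroup Matrix.frobeniusNormedSpace e * (2 * Real.sqrt (Fintype.card mm)) * (Real.sqrt (Fintype.card mm) * (((((L ^ kk : ℕ) : ℝ))⁻¹) * p)) := by gcongr; exact hC1 k μ x hx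
      _ = ((((L ^ kk : ℕ) : ℝ))⁻¹) * (@basisConst ι _ (Matrix mm mm ℂ) Matrix.frobeniusNormedAddCommGroup Matrix.frobeniusNormedSpace e * (2 * Real.sqrt (Fintype.card mm)) * (Real.sqrt (Fintype.card mm) * p)) := by ring
  have hE2 : ∀ (k : Fin (d + 1) → ZMod (2 * L)) (μ : Fin (d + 1)) (x : ScX d L mv kk hL), x ∈ Qc k → ∀ i j, |((fun μ x => coordMat e (ContinuousLinearMap.mulLeftRight ℝ (Matrix mm mm ℂ) (u' k (kingSec (cvM d L mv kk hL) L kk r x) * U μ x * (u' k (kingSec (cvM d L mv kk hL) L kk r (scShift d L mv kk hL μ x)))ᴴ) (u' k (kingSec (cvM d L mv kk hL) L kk r x) * U μ x * (u' k (kingSec (cvM d L mv kk hL) L kk r (scShift d L mv kk hL μ x)))ᴴ)ᴴ)) μ x - (fun μ x => coordMat e (ContinuousLinearMap.mulLeftRight ℝ (Matrix mm mm ℂ) (u' k (kingSec (cvM d L mv kk hL) L kk r x) * U μ x * (u' k (kingSec (cvM d L mv kk hL) L kk r (scShift d L mv kk hL μ x)))ᴴ) (u' k (kingSec (cvM d L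 mv kk hL) L kk r x) * U μ x * (u' k (kingSec (cvM d L mv kk hL) L kk r (scShift d L mv kk hL μ x)))ᴴ)ᴴ)) μ ((scShift d L mv kk hL μ).symm x)) i j| ≤ ((((L ^ kk : ℕ) : ℝ))⁻¹) ^ 2 * (@basisConst ι _ (Matrix mm mm ℂ) Matrix.frobeniusNormedAddCommGroup Matrix.frobeniusNormedSpace e * (2 * Real.sqrt (Fintype.card mm)) * (Real.sqrt (Fintype.card mm) * q)) := fun k μ x hx i j => by
    refine (uN_abs_coordMat_conj_sub_conj_entry_le_op e (hVu k μ ((scShift d L mv kk hL μ).symm x)) (hVu k μ x) i j).trans ?_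
    calc @basisConst ι _ (Matrix mm mm ℂ) Matrix.frobeniusNormedAddCommGroup Matrix.frobeniusNormedSpace e * (2 * Real.sqrt (Fintype.card mm)) * (Real.sqrt (Fintype.card mm) * ‖(u' k (kingSec (cvM d L mv kk hL) L kk r x) * U μ x * (u' k (kingSec (cvM d L mv kk hL) L kk r (scShift d L mv kk hL μ x)))ᴴ) - (u' k (kingSec (cvM d L mv kk hL) L kk r ((scShift d L mv kk hL μ).symm x)) * U μ ((scShift d L mv kk hL μ).symm x) * (u' k (kingSec (cvM d L mv kk hL) L kk r (scShift d L mv kk hL μ ((scShift d L mv kk hL μ).symm x))))ᴴ)‖) ≤ @basisConst ι _ (Matrix mm mm ℂ) Matrix.frobeniusNormedAddCommGroup Matrix.frobeniusNormedSpace e * (2 * Real.sqrt (Fintype.card mm)) * (Real.sqrt (Fintype.card mm) * (((((L ^ kk : ℕ) : ℝ))⁻¹) ^ 2 * q)) := by gcongr; exact hC2 k μ x hx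
      _ = ((((L ^ kk : ℕ) : ℝ))⁻¹) ^ 2 * (@basisConst ι _ (Matrix mm mm ℂ) Matrix.frobeniusNormedAddCommGroup Matrix.frobeniusNormedSpace e * (2 * Real.sqrt (Fintype.card mm)) * (Real.sqrt (Fintype.card mm) * q)) := by ring
  have hSo' : ∀ (k : Fin (d + 1) → ZMod (2 * L)) (μ : Fin (d + 1)) (z : ScX' d L mv kk r hL), (fun μ x' => coordMat e (ContinuousLinearMap.mulLeftRight ℝ (Matrix mm mm ℂ) (u' k x' * U' μ x' * (u' k (scShift' d L mv kk r hL μ x'))ᴴ) (u' k x' * U' μ x' * (u' k (scShift' d L mv kk r hL μ x'))ᴴ)ᴴ)) μ z * ((fun μ x' => coordMat e (ContinuousLinearMap.mulLeftRight ℝ (Matrix mm mm ℂ) (u' k x' * U' μ x' * (u' k (scShift' d L mv kk r hL μ x'))ᴴ) (u' k x' * U' μ x' * (u' k (scShift' d L mv kk r hL μ x'))ᴴ)ᴴ)) μ z)ᵀ = 1 := fun k μ z => (uN_coordMat_conj_orthogonal e he (hV'u k μ z)).2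
  have hSo : ∀ (k : Fin (d + 1) → ZMod (2 * L)) (μ : Fin (d + 1)) (x : ScX d L mv kk hL), (fun μ x => coordMat e (ContinuousLinearMap.mulLeftRight ℝ (Matrix mm mm ℂ) (u' k (kingSec (cvM d L mv kk hL) L kk r x) * U μ x * (u' k (kingSec (cvM d L mv kk hL) L kk r (scShift d L mv kk hL μ x)))ᴴ) (u' k (kingSec (cvM d L mv kk hL) L kk r x) * U μ x * (u' k (kingSec (cvM d L mv kk hL) L kk r (scShift d L mv kk hL μ x)))ᴴ)ᴴ)) μ x * ((fun μ x => coordMat e (ContinuousLinearMap.mulLeftRight ℝ (Matrix mm mm ℂ) (u' k (kingSec (cvM d L mv kk hL) L kk r x) * U μ x * (u' k (kingSec (cvM d L mv kk hL) L kk r (scShift d L mv kk hL μ x)))ᴴ) (u' k (kingSec (cvM d L mv kk hL) L kk r x) * U μ x * (u' k (kingSec (cvM d L mv kk hL) L kk r (scShift d L mv kk hL μ x)))ᴴ)ᴴ)) μ x)ᵀ = 1 := fun k μ x => (uN_coordMat_conj_orthogonal e he (hVu k μ x)).2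
  -- 339's coefficient letters `hCloc hAloc hCloc′ hAloc′` (dag-n15-w2 §1, pointwise)
  have hAloc' : ∀ k j' x', scChi' d L mv kk r hL k x' ≠ 0 → ∀ i, ∑ j, |tCoefA ((((L ^ r * L ^ kk : ℕ) : ℝ))⁻¹) (gaugePair (scShift' d L mv kk r hL) (fun μ x' => coordMat e (ContinuousLinearMap.mulLeftRight ℝ (Matrix mm mm ℂ) (u' k x' * U' μ x' * (u' k (scShift' d L mv kk r hL μ x'))ᴴ) (u' k x' * U' μ x' * (u' k (scShift' d L mv kk r hL μ x'))ᴴ)ᴴ))) j' x' i j| ≤ rV := fun k j' x' hx' i => by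
    obtain ⟨h0, h2⟩ := hQf k x' hx'
    cases j' with
    | inl μ => exact (rowSum_tCoefA_inl_le_at ((((L ^ r * L ^ kk : ℕ) : ℝ))⁻¹) (scShift' d L mv kk r hL) _ hη' (hE1' k μ x' h0) i).trans hrA
    | inr μ => exact (rowSum_tCoefA_inr_le_at ((((L ^ r * L ^ kk : ℕ) : ℝ))⁻¹) (scShift' d L mv kk r hL) _ hη' (hE1' k μ _ (h2 μ)) i).trans hrA
  have hCloc' : ∀ k x', scChi' d L mv kk r hL k x' ≠ 0 → ∀ i, ∑ j, |tCoefC ((((L ^ r * L ^ kk : ℕ) : ℝ))⁻¹) (gaugePair (scShift' d L mv kk r hL) (fun μ x' => coordMat e (ContinuousLinearMap.mulLeftRight ℝ (Matrix mm mm ℂ) (u' k x' * U' μ x' * (u' k (scShift' d L mv kk r hL μ x'))ᴴ) (u' k x' * U' μ x' * (u' k (scShift' d L mv kk r hL μ x'))ᴴ)ᴴ))) x' i j| ≤ rV := fun k x' hx' i =>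
    (rowSum_tCoefC_le_at ((((L ^ r * L ^ kk : ℕ) : ℝ))⁻¹) (scShift' d L mv kk r hL) _ hη' hP10 (hSo' k) (fun μ => hE1' k μ x' (hQf k x' hx').1) (fun μ => hE2' k μ x' (hQf k x' hx').1) i).trans hrC
  have hAloc : ∀ k j' x, scChi d L mv kk hL k x ≠ 0 → ∀ i, ∑ j, |tCoefA ((((L ^ kk : ℕ) : ℝ))⁻¹) (gaugePair (scShift d L mv kk hL) (fun μ x => coordMat e (ContinuousLinearMap.mulLeftRight ℝ (Matrix mm mm ℂ) (u' k (kingSec (cvM d L mv kk hL) L kk r x) * U μ x * (u' k (kingSec (cvM d L mv kk hL) L kk r (scShift d L mv kk hL μ x)))ᴴ) (u' k (kingSec (cvM d L mv kk hL) L kk r x) * U μ x * (u' k (kingSec (cvM d L mv kk hL) L kk r (scShift d L mv kk hL μ x)))ᴴ)ᴴ))) j' x i j| ≤ rV := fun k j' x hx i => by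
    obtain ⟨h0, h2⟩ := hQc k x hx
    cases j' with
    | inl μ => exact (rowSum_tCoefA_inl_le_at ((((L ^ kk : ℕ) : ℝ))⁻¹) (scShift d L mv kk hL) _ hη (hE1 k μ x h0) i).trans hrA
    | inr μ => exact (rowSum_tCoefA_inr_le_at ((((L ^ kk : ℕ) : ℝ))⁻¹) (scShift d L mv kk hL) _ hη (hE1 k μ _ (h2 μ)) i).trans hrA
  have hCloc : ∀ k x, scChi d L mv kk hL k x ≠ 0 → ∀ i, ∑ j, |tCoefC ((((L ^ kk : ℕ) : ℝ))⁻¹) (gaugePair (scShift d L mv kk hL) (fun μ x => coordMat e (ContinuousLinearMap.mulLeftRight ℝ (Matrix mm mm ℂ) (u' k (kingSec (cvM d L mv kk hL) L kk r x) * U μ x * (u' k (kingSec (cvM d L mv kk hL) L kk r (scShift d L mv kk hL μ x)))ᴴ) (u' k (kingSec (cvM d L mv kk hL) L kk r x) * U μ x * (u' k (kingSec (cvM d L mv kk hL) L kk r (scShift d L mv kk hL μ x)))ᴴ)ᴴ))) x i j| ≤ rV := fun k x hx i =>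
    (rowSum_tCoefC_le_at ((((L ^ kk : ℕ) : ℝ))⁻¹) (scShift d L mv kk hL) _ hη hP10 (hSo k) (fun μ => hE1 k μ x (hQc k x hx).1) (fun μ => hE2 k μ x (hQc k x hx).1) i).trans hrC
  -- the column letter of `Ad V′` on the plateau cube
  have hρ : ∀ (k : Fin (d + 1) → ZMod (2 * L)) (μ : Fin (d + 1)) (y' : ScX' d L mv kk r hL), scBlk' d L mv kk r hL y' ∈ cvSk d L mv kk hL k → ∀ j, ∑ i, |(coordMat e (ContinuousLinearMap.mulLeftRight ℝ (Matrix mm mm ℂ)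
      (u' k y' * U' μ y' * (u' k (y' + unitVec (fine (L ^ r * L ^ kk) (cvM d L mv kk hL)) μ))ᴴ) (u' k y' * U' μ y' * (u' k (y' + unitVec (fine (L ^ r * L ^ kk) (cvM d L mv kk hL)) μ))ᴴ)ᴴ) - 1) i j| ≤ (Fintype.card ι * (((((L ^ r * L ^ kk : ℕ) : ℝ))⁻¹) * (@basisConst ι _ (Matrix mm mm ℂ) Matrix.frobeniusNormedAddCommGroup Matrix.frobeniusNormedSpace e * (2 * Real.sqrt (Fintype.card mm)) * (Real.sqrt (Fintype.card mm) * p)))) := fun k μ y' hy' j =>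
    calc _ ≤ ∑ _i : ι, ((((L ^ r * L ^ kk : ℕ) : ℝ))⁻¹) * (@basisConst ι _ (Matrix mm mm ℂ) Matrix.frobeniusNormedAddCommGroup Matrix.frobeniusNormedSpace e * (2 * Real.sqrt (Fintype.card mm)) * (Real.sqrt (Fintype.card mm) * p)) := Finset.sum_le_sum fun i _ => hE1' k μ y' (hQρ k y' hy') i j
      _ = (Fintype.card ι * (((((L ^ r * L ^ kk : ℕ) : ℝ))⁻¹) * (@basisConst ι _ (Matrix mm mm ℂ) Matrix.frobeniusNormedAddCommGroup Matrix.frobeniusNormedSpace e * (2 * Real.sqrt (Fintype.card mm)) * (Real.sqrt (Fintype.card mm) * p)))) := by rw [Finset.sum_const, Finset.card_univ, nsmul_eq_mul]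
  -- the partition sits in the cut box (for `hPloc`)
  have hhχ : ∀ (k : Fin (d + 1) → ZMod (2 * L)) (x : ScX d L mv kk hL), scH d L mv kk hL k x ≠ 0 → scChi d L mv kk hL k x ≠ 0 := fun k x hx => by
    have h := chiCube_box_eq_one_of_coverH_ne_zero (n := L ^ kk) hM hw hS6 0 k (x := (x, (0 : Fin (d + 1)))) (Or.inl rfl) hx
    rw [show scChi d L mv kk hL k x = chiCube (cvM d L mv kk hL) (L ^ kk) (coverCorner (cvM d L mv kk hL) (L ^ mv) L (2 * L ^ mv) k) (6 * L ^ mv + 1) (x, 0) from rfl, h]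
    exact one_ne_zero
  -- 339
  have key := H mv kk r hk hr hw₀' e he u' hu' U U' hU' (scP d L mv kk hL (aK a₀ (L : ℝ) kk * (((L ^ kk : ℕ) : ℝ)) ^ (d + 1)) ι e U) (scP' d L mv kk r hL (aK a₀ (L : ℝ) (r + kk) * (((L ^ r * L ^ kk : ℕ) : ℝ)) ^ (d + 1)) ι e U') (scNV d L mv kk hL (aK a₀ (L : ℝ) kk * (((L ^ kk : ℕ) : ℝ)) ^ (d + 1)) ι e (fun k x => u' k (kingSec (cvM d L mv kk hL) L kk r x)) U) (scNV' d L mv kk r hL (aK a₀ (L : ℝ) (r + kk) * (((L ^ r * L ^ kk : ℕ) : ℝ)) ^ (d + 1)) ι e u' U')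
    rV (a₀ * (Fintype.card ι * (Fintype.card ι * ((1 + rV * ((((L ^ kk : ℕ) : ℝ))⁻¹)) ^ ((d + 1) * L ^ kk) - 1) ^ 2 + 2 * ((1 + rV * ((((L ^ kk : ℕ) : ℝ))⁻¹)) ^ ((d + 1) * L ^ kk) - 1))) + a₀ * (Fintype.card ι * (Fintype.card ι * ((1 + rV * ((((L ^ r * L ^ kk : ℕ) : ℝ))⁻¹)) ^ ((d + 1) * (L ^ r * L ^ kk)) - 1) ^ 2 + 2 * ((1 + rV * ((((L ^ r * L ^ kk : ℕ) : ℝ))⁻¹)) ^ ((d + 1) * (L ^ r * L ^ kk)) - 1)))) 0 0 oV oN o (Fintype.card ι * (((((L ^ r * L ^ kk : ℕ) : ℝ))⁻¹) * (@basisConst ι _ (Matrix mm mm ℂ) Matrix.frobeniusNormedAddCommGroup Matrix.frobeniusNormedSpace e * (2 * Real.sqrt (Fintype.card mm)) * (Real.sqrt (Fintype.card mm) * p)))) hrV hRN0 le_rfl hoV hoN (by positivity) hRle hole hθ₀.le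
    (fun k => scP_conj ι e (aK a₀ (L : ℝ) kk * (((L ^ kk : ℕ) : ℝ)) ^ (d + 1)) (fun k x => u' k (kingSec (cvM d L mv kk hL) L kk r x)) U k) (fun k => scP'_conj ι e (aK a₀ (L : ℝ) (r + kk) * (((L ^ r * L ^ kk : ℕ) : ℝ)) ^ (d + 1)) u' U' k) hCloc hAloc hCloc' hAloc' hfitC hfitA
    (fun k => (hasMaj_scNV_cut_of_rows ι e he (aK a₀ (L : ℝ) kk * (((L ^ kk : ℕ) : ℝ)) ^ (d + 1)) hW U hrV k (fun μ x hx i => hAloc k (Sum.inl μ) x hx i) δ).mono fun y y' =>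
      mul_le_mul_of_nonneg_right (by rw [habs]; nlinarith [mul_le_mul_of_nonneg_right haKle hSc0, mul_nonneg ha₀.le hSf0]) (Real.exp_nonneg _))
    (fun k => (hasMaj_scNV'_cut_of_rows ι e he (aK a₀ (L : ℝ) (r + kk) * (((L ^ r * L ^ kk : ℕ) : ℝ)) ^ (d + 1)) hu' U' hrV k (fun μ x hx i => hAloc' k (Sum.inl μ) x hx i) δ).mono fun y y' =>
      mul_le_mul_of_nonneg_right (by rw [habs']; nlinarith [mul_le_mul_of_nonneg_right haKle' hSf0, mul_nonneg ha₀.le hSc0]) (Real.exp_nonneg _))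
    hDNV
    (fun k => by
      rw [one_sub_scPsi_comp_scNV_comp_scChi ι e he hM hm₁ hfitI hS0 (aK a₀ (L : ℝ) kk * (((L ^ kk : ℕ) : ℝ)) ^ (d + 1)) hW U k]
      exact (hasMaj_zero _ _).mono fun y y' => by positivity)
    (fun k => by
      rw [one_sub_scPsi'_comp_scNV'_comp_scChi' ι e he hM hm₁ hfitI hS0 (aK a₀ (L : ℝ) (r + kk) * (((L ^ r * L ^ kk : ℕ) : ℝ)) ^ (d + 1)) hu' U' k]
      exact (hasMaj_zero _ _).mono fun y y' => by positivity)
    (fun k => by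
      rw [one_sub_scPsi_comp_scNV_comp_scChi ι e he hM hm₁ hfitI hS0 (aK a₀ (L : ℝ) kk * (((L ^ kk : ℕ) : ℝ)) ^ (d + 1)) hW U k, one_sub_scPsi'_comp_scNV'_comp_scChi' ι e he hM hm₁ hfitI hS0 (aK a₀ (L : ℝ) (r + kk) * (((L ^ r * L ^ kk : ℕ) : ℝ)) ^ (d + 1)) hu' U' k, idef_zero]
      exact (hasMaj_zero _ _).mono fun y y' => by positivity)
    hρ (fun k => mulOp_one_sub_scPsi_comp_csavgGram_comp_mulOp_scH ι hM hmg₂ hfg₂ hS0 (cvT e U) (aK a₀ (L : ℝ) kk * (((L ^ kk : ℕ) : ℝ)) ^ (d + 1)) k (hhχ k))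
  exact key.mono fun y y' => le_of_eq (by rw [add_zero])

end Green

end Summit.QuantumFields.YangMills.BalabanUVNodes.N15.Gluing

end
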